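import Summits.BirchSwinnertonDyer.BirchSwinnertonDyer.Theorems.EisensteinPrimesResidualDevissageFiniteKernel
import Literature.NumberTheory.EllipticCurves.GreenbergStrictSelmerDualMuProofs
import HarnessLib

/-!
# Route `TwoAdicConverse` (rung S3), crux `OrdLambdaHalfAtTwo` (item stmt-BirchSwinnertonDyer-19556), line
# `kato-determinant-greenberg-two`: **B2 (the Greenberg dual `X_Gr` is finitely generated, `Λ`-TORSION, `μ = 0`)
# ⟸ finiteness of the two `GL(1)` residual Selmer groups of a stable line** — the reducible dévissage of the
# card, composed from TREE theorems

Cell `bsd-2adic`, seat `bsd-2adic-conv-1` GEN 24 (`--supports` stmt-BirchSwinnertonDyer-19556; helper; route-independent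
imports).  The registered skeleton `Cruxes/OrdLambdaHalfAtTwo/Lines/kato_determinant_greenberg_two.lean` (skeleton
`037466d7c4ab`) carries, inside its supply stub `stub_greenbergSupplyAtTwo`, ONE research clause (B2): for `W/ℚ` on the
rational-`2`-torsion stratum (β), a Greenberg field `K` (every prime of `2N_E` split), a prime `w ∣ 2`, the cyclotomic
`ℤ₂`-extension `κ_K` of `K` with topological generator `γ_K`, the Pontryagin dual `X_Gr` of the GREENBERG Selmer group
of `E[2^∞]` over `K_∞` (STRICT at `w`, RELAXED at `w̄` = the tree's Castella data `AcSelmer.bdpData _ 2 w`, by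
definition the skeleton's `grData W K w`) is **finitely generated and `Λ`-torsion**.  The card's road for B2 («`GL(1)/K`
dévissage along `0 → 𝔽₂(φ) → E[2] → 𝔽₂(ψ) → 0` + Ferrero–Washington») is assembled here in the KERNEL from tree theorems,
for ANY `ℤ_p`-extension, ANY prime, ANY `Γ_K`-stable subgroup `Φ ≤ E[p]`:

* `finite_pTorsion_strictSelmerInfty_bdpData_of_residual` — if the place `w ∋ p` is finitely decomposed in `K_∞`
  (`D_w ⊄ ker κ`), `Σ` contains the bad places prime to `p`, and the two RESIDUAL Castella Selmer groups
  `R_w^Σ(K_∞, Φ)` and `R_w^Σ(K_∞, E[p]/Φ)` (`GreenbergVatsal2000.datumStrictSelmer … (AcSelmer.bdpData …) Σ`) are finite,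
  then the `p`-torsion of Greenberg's strict Selmer group `Sel^{str}_{bdp}(K_∞, E[p^∞])`
  (`GreenbergSelmer.strictSelmerInfty κ E[p^∞] (bdpData E[p^∞] p w)`) is finite: the cell `bsd-eis`'s
  `ResidualDevissageFiniteKernel.finite_selmerAc_pTorsion_of_line_devissage_of_finite` (CGLS Prop. 17–18 / Lim–Sujatha, NO
  non-anomalous clause, NO parity of `p`) for Castella's `Sel_w^Σ`, and `Sel^{str}_{bdp} = Sel_w^∅ ≤ Sel_w^Σ`
  (`AcSelmer.selmerOver_empty_eq_strictSelmerGroupOver`, `selmerAc_empty_le`);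
* **`greenbergStrictSelmerDual_finite_torsion_mu_of_residual`** — hence EVERY dual datum
  `D : (W.baseChange K).GreenbergStrictSelmerDualData κ γ (bdpData _ p w)` (Literature p656787) has `D.X` finitely generated
  over `Λ`, `Λ`-TORSION and `μ(D.X) = 0` (Literature p657755 `finite_torsion_mu_of_finite_pTorsion`).  This is B2 with a
  `μ = 0` bonus, for the skeleton's `DGr` once `GrDualData := GreenbergStrictSelmerDualData (W.baseChange K)` and
  `grData = bdpData` (both definitional), MODULO the two `GL(1)` residual finiteness inputs.

WHAT REMAINS OF B2 (stated, not proved): on (β) take `Φ` = the line through the rational point of order `2`; `Φ` and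
`E[2]/Φ` have order `2`, hence TRIVIAL `Γ_K`-action, and `R_w^Σ(K^{cyc}_∞, 𝔽₂)` = `Hom(Gal(M/K_∞), 𝔽₂)` for `M` the maximal
abelian pro-`2` extension of `K_∞` unramified outside `Σ ∪ {w̄}` and split at `w`; its finiteness is «`X_{Σ ∪ {w̄}}(K^{cyc}_∞)`
is finitely generated over `ℤ₂`» — `μ = 0` by Ferrero–Washington for the abelian field `K`, `Λ`-torsion by Leopoldt for
the abelian layers `K·ℚ_n` (Brumer) — a statement of the classical Iwasawa theory of `K`, to be typed as a named fact by
the line's B2 author (this file does not state it).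

HONEST FRAMING.  Composition of tree theorems; no named fact, no definition, no `sorry`; nothing about any particular curve
is asserted; BSD is not proved by any of this.  PARTITION (D-0054): none — RANK axis S3 × X5@2 stratum (β).

References: F. Castella, G. Grossi, J. Lee, C. Skinner, Invent. Math. 227 (2022) §1.4 Props. 17–18 [CastellaGrossiLeeSkinner2022];
M. F. Lim, R. Sujatha, §3 Prop. 3.2 [LimSujatha2018]; R. Greenberg, V. Vatsal, Invent. Math. 142 (2000) §2 [GreenbergVatsal2000];
R. Greenberg, LNM 1716 (1999) §1 [GreenbergLNM1716]; F. Castella, Math. Ann. (2018) Def. 2.2 [Castella2018].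
-/

set_option linter.dupNamespace false
set_option autoImplicit false

noncomputable section

open scoped Classical

namespace Summit.BirchSwinnertonDyer.BirchSwinnertonDyer.Theorems.TwoAdicGreenbergCotorsion

open NumberField IsDedekindDomain Field WeierstrassCurve
open Literature.NumberTheory.EllipticCurves Literature.NumberTheory.EllipticCurves.GreenbergSelmer
  Literature.NumberTheory.EllipticCurves.GreenbergVatsal2000
  Summit.BirchSwinnertonDyer.Rank1Residual.X11b Summit.BirchSwinnertonDyer.Rank1Residual.X11b.AcSelmer
  Summit.BirchSwinnertonDyer.Rank1Residual.X2.ResidualDevissageModules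
  Summit.BirchSwinnertonDyer.BirchSwinnertonDyer.Theorems.ResidualDevissageFiniteKernel

variable {K : Type} [Field K] [NumberField K] (V : WeierstrassCurve K) [V.IsElliptic] {p : ℕ} [Fact p.Prime]
  (κ : ZpExtension K p)

omit [V.IsElliptic] in
/-- **Greenberg's strict Selmer group for Castella's data IS Castella's `Sel_w^∅`** (`GreenbergSelmer.strictSelmerInfty` for
`bdpData` = `AcSelmer.selmerAc … ∅`; tree `selmerOver_empty_eq_strictSelmerGroupOver`). [cite: Castella2018, Def. 2.2] -/
theorem strictSelmerInfty_bdpData_eq_selmerAc_empty {w : HeightOneSpectrum (𝓞 K)} (hw : ((p : ℕ) : 𝓞 K) ∈ w.asIdeal) :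
    GreenbergSelmer.strictSelmerInfty κ (↥(V.geomPrimaryTorsion p)) (AcSelmer.bdpData _ p w) =
      AcSelmer.selmerAc V p κ w ∅ := by
  have h := AcSelmer.selmerOver_empty_eq_strictSelmerGroupOver (H := κ.kerSubgroup)
    (M := ↥(V.geomPrimaryTorsion p)) p hw
  -- `strictSelmerInfty κ M L = strictSelmerGroupOver (ker κ) M p L` and `selmerAc = selmerOver (ker κ) …` by definition
  exact h.symm

omit [V.IsElliptic] in
/-- `Sel^{str}_{bdp}(K_∞, E[p^∞]) ≤ Sel_w^Σ(K_∞, E[p^∞])` for every `Σ` (imprimitivity only drops conditions).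
[cite: Castella2018, Def. 2.2] -/
theorem strictSelmerInfty_bdpData_le_selmerAc {w : HeightOneSpectrum (𝓞 K)} (hw : ((p : ℕ) : 𝓞 K) ∈ w.asIdeal)
    (S : Set (HeightOneSpectrum (𝓞 K))) :
    GreenbergSelmer.strictSelmerInfty κ (↥(V.geomPrimaryTorsion p)) (AcSelmer.bdpData _ p w) ≤
      AcSelmer.selmerAc V p κ w S := by
  rw [strictSelmerInfty_bdpData_eq_selmerAc_empty V κ hw]
  exact AcSelmer.selmerAc_empty_le

/-- **`Sel^{str}_{bdp}(K_∞, E[p^∞])[p]` is finite from the residual dévissage along a stable subgroup `Φ ≤ E[p]`.**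
For ANY `ℤ_p`-extension `κ` of the number field `K`, a place `w ∋ p` with `D_w ⊄ ker κ`, a set `Σ` containing every bad
place prime to `p`, and a `Γ_K`-stable `Φ ≤ E[p]` whose two residual Castella Selmer groups `R_w^Σ(K_∞, Φ)`,
`R_w^Σ(K_∞, E[p]/Φ)` are finite: `{s ∈ Sel^{str}_{bdp}(K_∞, E[p^∞]) | p·s = 0}` is finite
(tree `finite_selmerAc_pTorsion_of_line_devissage_of_finite` + `Sel^{str}_{bdp} ≤ Sel_w^Σ`).
[cite: CastellaGrossiLeeSkinner2022, §1.4 Props. 17–18] [cite: LimSujatha2018, §3 Prop. 3.2] -/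
theorem finite_pTorsion_strictSelmerInfty_bdpData_of_residual
    {w : HeightOneSpectrum (𝓞 K)} (hw : ((p : ℕ) : 𝓞 K) ∈ w.asIdeal) (hwdec : ¬ (decomp w ≤ κ.kerSubgroup))
    {S : Set (HeightOneSpectrum (𝓞 K))}
    (hS : ∀ v : HeightOneSpectrum (𝓞 K), v ∉ S → ((p : ℕ) : 𝓞 K) ∉ v.asIdeal → V.HasGoodReductionAt v)
    (Φ : StableSubgroup (absoluteGaloisGroup K) (V.geomTorsion (p : ℤ)))
    (hΦ : (datumStrictSelmer κ.kerSubgroup Φ.Sub p (AcSelmer.bdpData Φ.Sub p w) S :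
      Set (Literature.NumberTheory.EllipticCurves.subgroupH1 κ.kerSubgroup Φ.Sub)).Finite)
    (hΨ : (datumStrictSelmer κ.kerSubgroup Φ.Quot p (AcSelmer.bdpData Φ.Quot p w) S :
      Set (Literature.NumberTheory.EllipticCurves.subgroupH1 κ.kerSubgroup Φ.Quot)).Finite) :
    Set.Finite {s : GreenbergSelmer.strictSelmerInfty κ (↥(V.geomPrimaryTorsion p)) (AcSelmer.bdpData _ p w) |
      p • s = 0} := by
  have hfin := finite_selmerAc_pTorsion_of_line_devissage_of_finite V κ hw hwdec hS Φ hΦ hΨ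
  have hle := strictSelmerInfty_bdpData_le_selmerAc V κ hw S
  -- transport finiteness along the inclusion of subgroups, through the ambient `H¹(K_∞, E[p^∞])`
  have h1 : (Subtype.val '' {s : AcSelmer.selmerAc V p κ w S | p • s = 0}).Finite := hfin.image _
  refine Set.Finite.of_finite_image (h1.subset ?_) Subtype.val_injective.injOn
  rintro _ ⟨s, hs, rfl⟩
  have hs' : p • (s : V.subgroupH1 p κ.kerSubgroup) = 0 := by
    have h := congrArg Subtype.val (show p • s = 0 from hs)
    rwa [AddSubgroupClass.coe_nsmul, ZeroMemClass.coe_zero] at h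
  refine ⟨⟨(s : V.subgroupH1 p κ.kerSubgroup), hle s.2⟩, ?_, rfl⟩
  show p • (⟨(s : V.subgroupH1 p κ.kerSubgroup), hle s.2⟩ : AcSelmer.selmerAc V p κ w S) = 0
  exact Subtype.ext (by rw [AddSubgroupClass.coe_nsmul, ZeroMemClass.coe_zero]; exact hs')

/-- **B2 ⟸ the two `GL(1)` residual finiteness inputs.**  With the data of
`finite_pTorsion_strictSelmerInfty_bdpData_of_residual` and a topological generator `γ` of `κ`, EVERY Pontryagin-dual datum
`D` of the Greenberg strict Selmer group `Sel^{str}_{bdp}(K_∞, E[p^∞])` (Literature `GreenbergStrictSelmerDualData`) has `D.X`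
finitely generated over `Λ`, `Λ`-torsion, and `μ(D.X) = 0`. For the kato-determinant line: `V = W.baseChange K`, `p = 2`,
`κ` the cyclotomic `ℤ₂`-extension of the Greenberg field `K`, `w ∣ 2`, `Φ` the line of the rational `2`-torsion point.
[cite: CastellaGrossiLeeSkinner2022, §1.4 Props. 17–18] [cite: GreenbergLNM1716, §1 p. 60] -/
theorem greenbergStrictSelmerDual_finite_torsion_mu_of_residual
    {γ : absoluteGaloisGroup K} (hγ : κ.IsTopGenerator γ)
    {w : HeightOneSpectrum (𝓞 K)} (hw : ((p : ℕ) : 𝓞 K) ∈ w.asIdeal) (hwdec : ¬ (decomp w ≤ κ.kerSubgroup))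
    {S : Set (HeightOneSpectrum (𝓞 K))}
    (hS : ∀ v : HeightOneSpectrum (𝓞 K), v ∉ S → ((p : ℕ) : 𝓞 K) ∉ v.asIdeal → V.HasGoodReductionAt v)
    (Φ : StableSubgroup (absoluteGaloisGroup K) (V.geomTorsion (p : ℤ)))
    (hΦ : (datumStrictSelmer κ.kerSubgroup Φ.Sub p (AcSelmer.bdpData Φ.Sub p w) S :
      Set (Literature.NumberTheory.EllipticCurves.subgroupH1 κ.kerSubgroup Φ.Sub)).Finite)
    (hΨ : (datumStrictSelmer κ.kerSubgroup Φ.Quot p (AcSelmer.bdpData Φ.Quot p w) S :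
      Set (Literature.NumberTheory.EllipticCurves.subgroupH1 κ.kerSubgroup Φ.Quot)).Finite)
    (D : V.GreenbergStrictSelmerDualData κ γ (AcSelmer.bdpData _ p w)) :
    Module.Finite (IwasawaAlgebra p) D.X ∧ Module.IsTorsion (IwasawaAlgebra p) D.X ∧ muInvariant p D.X = 0 :=
  D.finite_torsion_mu_of_finite_pTorsion hγ
    (finite_pTorsion_strictSelmerInfty_bdpData_of_residual V κ hw hwdec hS Φ hΦ hΨ)

end Summit.BirchSwinnertonDyer.BirchSwinnertonDyer.Theorems.TwoAdicGreenbergCotorsion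

end
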